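import Summits.HubbardSuperconductivity.HubbardSuperconductivity.Theorems.BirComplexStableXY.Negative.BirComplexStableXYFalseOfCubicModulusCrossing
import Summits.HubbardSuperconductivity.HubbardSuperconductivity.Theorems.BalabanIRBirGappedPhaseReductionVacuousCrossing

/-!
# Route BalabanIR — support item `BirGappedPhaseReduction` (stmt-HubbardSuperconductivity-2082) closed MODULO `CubicModulusCrossing`

Bookkeeping update of `Theorems/BalabanIRBirGappedPhaseReductionVacuousCrossing.lean` (prover seat c4-0, 2026-08-16).
The rev-0 reduction record `BirGappedPhaseReduction := BirComplexStableXY → BirGroundStateAverageLRO` is glue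
(`¬ item ↔ engine ∧ ¬ target`, `Theorems.not_birGappedPhaseReduction_iff`); the negative lane of crux
stmt-HubbardSuperconductivity-2080 is now ALSO closed modulo `CubicModulusCrossing`
(`Theorems/BirComplexStableXY/Negative/BirComplexStableXYFalseOfCubicModulusCrossing.lean`: modulus crossing in the
cubic time-odd Berry family `cubicTab ε₂ ζ`, whose charge-sector crossings are robust at LEADING semiclassical order,
unlike the 0↔1 crossing of the stiffness family behind `StiffModulusCrossing`).  Composing with ex falso: the
construction item for ANY of the four hearts settles stmt-2080 (refuted) and stmt-2082 (proved, vacuously) at once.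
This file imports `Theses.BalabanIR` transitively and is NOT a closing module (materialisation rule of the route); it is
a `--supports stmt-HubbardSuperconductivity-2082` record.  No definition is introduced.
-/

set_option linter.dupNamespace false

namespace Summit.HubbardSuperconductivity.HubbardSuperconductivity.Theorems

open Summit.HubbardSuperconductivity.HubbardSuperconductivity.Theses.BalabanIR
open Summit.HubbardSuperconductivity.BirComplexStableXYNegative

/-- `BirGappedPhaseReduction` (stmt-HubbardSuperconductivity-2082) holds modulo `CubicModulusCrossing`:
modulus crossing in the cubic Berry family refutes the antecedent `BirComplexStableXY`, so the implication holds
vacuously.  (Composition of `BirComplexStableXY_false_of_CubicModulusCrossing` with ex falso.) [folklore] -/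
theorem birGappedPhaseReduction_of_cubicModulusCrossing (hC : CubicModulusCrossing) :
    BirGappedPhaseReduction :=
  fun hE => absurd hE (BirComplexStableXY_false_of_CubicModulusCrossing hC)

/-- Any of the four analytic hearts of the engine's negative lane closes stmt-2082. [folklore] -/
theorem birGappedPhaseReduction_of_hearts'
    (h : WitnessZeroExists ∨ StiffTwoLevelStructure ∨ StiffModulusCrossing ∨ CubicModulusCrossing) :
    BirGappedPhaseReduction :=
  h.elim birGappedPhaseReduction_of_witnessZeroExists fun h' =>
    h'.elim birGappedPhaseReduction_of_stiffTwoLevelStructure fun h'' =>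
      h''.elim birGappedPhaseReduction_of_stiffModulusCrossing birGappedPhaseReduction_of_cubicModulusCrossing

end Summit.HubbardSuperconductivity.HubbardSuperconductivity.Theorems
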